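import Summits.BirchSwinnertonDyer.BirchSwinnertonDyer.Theorems.ResidualThetaTransportAtTwoHeckeThetaPartnerAdicAtTwoHeckeThetaClassSeries
import Summits.BirchSwinnertonDyer.BirchSwinnertonDyer.Theorems.ResidualThetaTransportAtTwoHeckeThetaPartnerAdicAtTwoHeckeThetaNebentypus
import Summits.BirchSwinnertonDyer.BirchSwinnertonDyer.Theorems.ResidualThetaTransportAtTwoHeckeThetaPartnerAdicAtTwoThetaClassWeighted
import Summits.BirchSwinnertonDyer.BirchSwinnertonDyer.Theorems.ResidualThetaTransportAtTwoHeckeThetaPartnerAdicAtTwoCuspFormOfSpan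
import Literature.NumberTheory.LFunctions.RayClassOrbitSums
import Mathlib.LinearAlgebra.FreeModule.IdealQuotient
import HarnessLib

/-!
# Hecke's weight-two theta series `θ_ψ` as a cusp form on `Γ₀(|d_K| N𝔪)` (toward K0⁺, stmt-20690)

Route `ResidualThetaTransportAtTwo`, crux K0⁺ `HeckeThetaPartnerAdicAtTwo` (stmt-BirchSwinnertonDyer-20690),
line "Hecke theta series from the genus-two Riemann theta function".  THEOREMS ONLY.

**`exists_heckeTheta_cuspForm`.**  `K` imaginary quadratic with Kronecker character `κ`,
`σ : K → ℂ`, `𝔪 ≠ 0, 1`, `ψ` the prime values of a weight-2 Größencharakter mod `𝔪`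
(`ψ̃((b)) = ψ̃((c)) σ(b/c)` on the ray, `ψ(𝔭) ≠ 0` off `𝔪`) with `ψ̃((n)) = (d_K/n) n` for odd `n`
prime to `|d_K| N𝔪`.  Then there is a cusp form `g ∈ S₂(Γ₀(|d_K|·N𝔪))` with
`g(τ) = Σ_{n ≥ 1} (Σ_{N𝔞 = n, (𝔞, 𝔪) = 1} ψ̃(𝔞)) qⁿ`.
Construction: `g = Σ_c (2πi w ψ̃(𝔞_c))⁻¹ F_{𝔞_c}` over class representatives `𝔞_c` prime to `𝔪`
(`F_𝔞` the class theta series of `HeckeThetaClass`; law `classTheta_moeb`, trivial Nebentypus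
`kappa_mul_chi_eq_one`, membership in the theta span `classTheta_mem_span`, cusp form
`exists_cuspForm_of_mem_span`, coefficients `hasSum_classTheta_nat` + `sum_weighted_norm_eq`).

BSD is not proved by this file.
-/

set_option autoImplicit false
set_option linter.dupNamespace false

noncomputable section

open scoped NumberField ComplexConjugate Real MatrixGroups UpperHalfPlane ModularForm nonZeroDivisors
open NumberField Module Matrix Complex Filter IsDedekindDomain CongruenceSubgroup

namespace Summit.BirchSwinnertonDyer.BirchSwinnertonDyer.Theorems.HeckeTheta

open Literature.Analysis.SpecialFunctions
open Literature.NumberTheory.ModularForms.BinaryTheta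
open Literature.NumberTheory.Automorphic (siegelUpperHalfSpace mem_siegelUpperHalfSpace_iff)
open Literature.NumberTheory.LFunctions (idealPow rayClassCoeff exists_isCoprime_mk0_eq)
open Literature.NumberTheory.EllipticCurves.ModularForms (rayClassCoeff_mul_of_ne_bot)

variable {K : Type} [Field K] [NumberField K]

/-! ### Auxiliary -/

/-- `ψ̃_𝔪(𝔞) ≠ 0` for `𝔞 ≠ 0` prime to `𝔪` when `ψ(𝔭) ≠ 0` for `𝔭 ∤ 𝔪`. -/
theorem rayClassCoeff_ne_zero_of_isCoprime {𝔪 𝔞 : Ideal (𝓞 K)} {ψ : HeightOneSpectrum (𝓞 K) → ℂ}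
    (hψ0 : ∀ v : HeightOneSpectrum (𝓞 K), ¬ 𝔪 ≤ v.asIdeal → ψ v ≠ 0) (h𝔞 : 𝔞 ≠ ⊥)
    (hcop : IsCoprime 𝔞 𝔪) : rayClassCoeff 𝔪 ψ 𝔞 ≠ 0 := by
  classical
  rw [rayClassCoeff, if_pos ⟨h𝔞, hcop⟩, idealPow]
  refine finprod_induction (fun z : ℂ => z ≠ 0) one_ne_zero (fun _ _ => mul_ne_zero) fun v => ?_
  by_cases hc : (Associates.mk v.asIdeal).count (Associates.mk 𝔞).factors = 0
  · rw [hc, pow_zero]; exact one_ne_zero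
  · refine pow_ne_zero _ (hψ0 v fun hle => ?_)
    have hdvd : v.asIdeal ∣ 𝔞 := (Associates.count_ne_zero_iff_dvd h𝔞 v.irreducible).mp hc
    have hc' : IsCoprime v.asIdeal 𝔪 := hcop.of_isCoprime_of_dvd_left hdvd
    rw [Ideal.isCoprime_iff_sup_eq, sup_eq_left.mpr hle] at hc'
    exact v.isPrime.ne_top hc'

/-- For `γ = (a b; c d) ∈ Γ₀(N)`: `N ∣ c` and `d` is prime to `N`. -/
theorem dvd_and_isCoprime_of_mem_Gamma0 {N : ℕ} {γ : SL(2, ℤ)} (hγ : γ ∈ Gamma0 N) :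
    (N : ℤ) ∣ (γ 1 0 : ℤ) ∧ IsCoprime (γ 1 1 : ℤ) (N : ℤ) := by
  have hc : (N : ℤ) ∣ (γ 1 0 : ℤ) := (ZMod.intCast_zmod_eq_zero_iff_dvd _ N).mp (Gamma0_mem.mp hγ)
  refine ⟨hc, ?_⟩
  obtain ⟨c', hc'⟩ := hc
  have hdet := Matrix.SpecialLinearGroup.det_coe γ
  rw [Matrix.det_fin_two, hc'] at hdet
  exact ⟨(γ 0 0 : ℤ), -((γ 0 1 : ℤ) * c'), by linear_combination hdet⟩

/-- Only the zero ideal has norm `0`: `Σ_{N𝔞 = 0} g(𝔞) = g(0)`. -/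
theorem finsum_absNorm_zero (g : Ideal (𝓞 K) → ℂ) :
    ∑ᶠ I ∈ {I : Ideal (𝓞 K) | Ideal.absNorm I = 0}, g I = g ⊥ := by
  have hset : {I : Ideal (𝓞 K) | Ideal.absNorm I = 0} = {⊥} := by
    ext I; simp [Ideal.absNorm_eq_zero_iff]
  rw [hset, finsum_mem_singleton]

/-- The sum over the subtype of ideals of norm `n` as a sum over the set. -/
theorem finsum_subtype_absNorm_eq (g : Ideal (𝓞 K) → ℂ) (n : ℕ) :
    ∑ᶠ J : {J : Ideal (𝓞 K) // Ideal.absNorm J = n}, g J.1 =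
      ∑ᶠ I ∈ {I : Ideal (𝓞 K) | Ideal.absNorm I = n}, g I :=
  finsum_set_coe_eq_finsum_mem {I : Ideal (𝓞 K) | Ideal.absNorm I = n}


/-! ### The cusp form -/

/-- **Hecke's weight-two theta series `θ_ψ ∈ S₂(Γ₀(|d_K|·N𝔪))` with
`θ_ψ(τ) = Σ_n (Σ_{N𝔞 = n} ψ̃_𝔪(𝔞)) qⁿ`.** -/
theorem exists_heckeTheta_cuspForm (hK : finrank ℚ K = 2) [IsTotallyComplex K] (σ : K →+* ℂ)
    {κ : DirichletCharacter ℂ (discr K).natAbs} (hprim : κ.IsPrimitive) (hodd : κ.Odd)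
    (hquad : κ ^ 2 = 1) (hκJ : ∀ n : ℕ, Odd n → κ n = (jacobiSym (discr K) n : ℂ))
    (hζ : ∀ s : ℂ, 1 < s.re → NumberField.dedekindZeta K s = riemannZeta s * LSeries (fun n => κ n) s)
    {𝔪 : Ideal (𝓞 K)} (h𝔪 : 𝔪 ≠ ⊥) (h𝔪1 : 𝔪 ≠ ⊤) {ψ : HeightOneSpectrum (𝓞 K) → ℂ}
    (hψ0 : ∀ v : HeightOneSpectrum (𝓞 K), ¬ 𝔪 ≤ v.asIdeal → ψ v ≠ 0)
    (hψ : ∀ b c : 𝓞 K, b ≠ 0 → c ≠ 0 → IsCoprime (Ideal.span {c}) 𝔪 → b - c ∈ 𝔪 →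
      idealPow K ψ (Ideal.span {b}) = idealPow K ψ (Ideal.span {c}) * σ ((b : K) / c))
    (hneb : ∀ n : ℕ, Odd n → n.Coprime ((discr K).natAbs * Ideal.absNorm 𝔪) →
      idealPow K ψ (Ideal.span {(n : 𝓞 K)}) = (jacobiSym (discr K) n : ℂ) * (n : ℂ))
    [NeZero ((discr K).natAbs * Ideal.absNorm 𝔪)] :
    ∃ g : CuspForm (Gamma0 ((discr K).natAbs * Ideal.absNorm 𝔪)) 2, ∀ τ : ℍ,
      HasSum (fun n : ℕ => (∑ᶠ J ∈ {J : Ideal (𝓞 K) | Ideal.absNorm J = n}, rayClassCoeff 𝔪 ψ J) *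
        cexp (2 * π * I * (τ : ℂ)) ^ n) (g τ) := by
  classical
  have hM : Ideal.absNorm 𝔪 ≠ 0 := by rw [Ne, Ideal.absNorm_eq_zero_iff]; exact h𝔪
  haveI hfu : Finite (𝓞 K)ˣ := finite_units hK
  have hw : ((Nat.card (𝓞 K)ˣ : ℕ) : ℂ) ≠ 0 := by exact_mod_cast Nat.card_pos.ne'
  have h2πI : (2 * π * I : ℂ) ≠ 0 := by simp [Real.pi_ne_zero]
  -- class representatives prime to `𝔪`
  choose 𝔞r h𝔞r0 h𝔞r using fun c : ClassGroup (𝓞 K) => exists_isCoprime_mk0_eq (K := K) h𝔪 c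
  have hrcc0 : ∀ c, rayClassCoeff 𝔪 ψ (𝔞r c) ≠ 0 := fun c =>
    rayClassCoeff_ne_zero_of_isCoprime hψ0 (h𝔞r0 c) (h𝔞r c).1
  have h𝔟0 : ∀ c, 𝔞r c * 𝔪 ≠ ⊥ := fun c => mul_ne_zero (h𝔞r0 c) h𝔪
  -- Gram data of `𝔟_c = 𝔞_c 𝔪`
  choose bc Bc hBc hsymmc h00c h11c hdetc hposc using fun c => exists_gram hK σ (h𝔟0 c)
  haveI hfin : ∀ c, Fintype (𝓞 K ⧸ 𝔞r c * 𝔪) := fun c =>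
    @Fintype.ofFinite _ (Ideal.finiteQuotientOfFreeOfNeBot _ (h𝔟0 c))
  have hmem : ∀ c (x₀ : 𝓞 K), x₀ ∈ 𝔞r c → (Ideal.absNorm 𝔪 : 𝓞 K) * x₀ ∈ 𝔞r c * 𝔪 :=
    fun c x₀ h => by simpa only [mul_comm x₀] using Ideal.mul_mem_mul h (Ideal.absNorm_mem 𝔪)
  -- the coset theta functions
  obtain ⟨Θ, hΘdef⟩ : ∃ Θ : ClassGroup (𝓞 K) → 𝓞 K → ℍ → ℂ, Θ = fun c x₀ (τ : ℍ) =>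
      if h : x₀ ∈ 𝔞r c then fderiv ℂ (riemannThetaChar
        (fun i => (((bc c).equivFun ⟨(Ideal.absNorm 𝔪 : 𝓞 K) * x₀, hmem c x₀ h⟩ i : ℤ) : ℂ) /
          (Ideal.absNorm 𝔪 : ℕ)) 0
        ((((Ideal.absNorm 𝔪 : ℕ) : ℂ) * (τ : ℂ)) • (Bc c).map ((↑) : ℤ → ℂ))) 0
        (fun i => σ (((bc c) i : 𝓞 K) : K))
      else 0 := ⟨_, rfl⟩
  have hΘ : ∀ c, ∀ x₀ ∈ 𝔞r c, ∀ k : Fin 2 → ℤ,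
      (((bc c).equivFun.symm k : ↥(𝔞r c * 𝔪)) : 𝓞 K) = (Ideal.absNorm 𝔪 : 𝓞 K) * x₀ →
      ∀ τ : ℍ, Θ c x₀ τ = fderiv ℂ (riemannThetaChar (fun i => (k i : ℂ) / (Ideal.absNorm 𝔪 : ℕ)) 0
        ((((Ideal.absNorm 𝔪 : ℕ) : ℂ) * (τ : ℂ)) • (Bc c).map ((↑) : ℤ → ℂ))) 0
        (fun i => σ (((bc c) i : 𝓞 K) : K)) := by
    intro c x₀ hx₀ k hk τ
    have hk' : (bc c).equivFun ⟨(Ideal.absNorm 𝔪 : 𝓞 K) * x₀, hmem c x₀ hx₀⟩ = k := by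
      have : (bc c).equivFun.symm k = ⟨_, hmem c x₀ hx₀⟩ := Subtype.ext hk
      rw [← this, LinearEquiv.apply_symm_apply]
    rw [hΘdef]
    simp only [dif_pos hx₀, hk']
  have hΘ0 : ∀ c x₀, x₀ ∉ 𝔞r c → ∀ τ : ℍ, Θ c x₀ τ = 0 := fun c x₀ h τ => by
    rw [hΘdef]; simp only [dif_neg h]
  have hρ : ∀ c (q : 𝓞 K ⧸ 𝔞r c * 𝔪), Ideal.Quotient.mk (𝔞r c * 𝔪) (Quotient.out q) = q :=
    fun c q => Ideal.Quotient.mk_out q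
  -- the class series and the normalised sum over classes
  obtain ⟨F, hFdef⟩ : ∃ F : ClassGroup (𝓞 K) → ℍ → ℂ, F = fun c (τ : ℍ) => ∑ q : 𝓞 K ⧸ 𝔞r c * 𝔪,
      rayClassCoeff 𝔪 ψ (Ideal.span {Quotient.out q}) / σ ((Quotient.out q : 𝓞 K) : K) *
        Θ c (Quotient.out q) τ := ⟨_, rfl⟩
  have hF : ∀ c τ, F c τ = ∑ q : 𝓞 K ⧸ 𝔞r c * 𝔪,
      rayClassCoeff 𝔪 ψ (Ideal.span {Quotient.out q}) / σ ((Quotient.out q : 𝓞 K) : K) *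
        Θ c (Quotient.out q) τ := fun c τ => by rw [hFdef]
  obtain ⟨coef, hcoef⟩ : ∃ coef : ClassGroup (𝓞 K) → ℂ, coef = fun c =>
      (2 * π * I * ((Nat.card (𝓞 K)ˣ : ℕ) : ℂ) * rayClassCoeff 𝔪 ψ (𝔞r c))⁻¹ := ⟨_, rfl⟩
  obtain ⟨f, hfdef⟩ : ∃ f : ℍ → ℂ, f = fun τ : ℍ => ∑ c, coef c * F c τ := ⟨_, rfl⟩
  -- (1) `f` lies in the theta span
  have hfspan : f ∈ Submodule.span ℂ {F : ℍ → ℂ | ∃ (P : Matrix (Fin 2) (Fin 2) ℚ), P.IsSymm ∧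
      (P.map (Rat.cast : ℚ → ℝ)).PosDef ∧ ∃ (a b : Fin 2 → ℚ) (u : Fin 2 → ℂ), F = fun τ : ℍ =>
        fderiv ℂ (riemannThetaChar (fun i => (a i : ℂ)) (fun i => (b i : ℂ))
          ((τ : ℂ) • P.map (Rat.cast : ℚ → ℂ))) 0 u} := by
    have hfeq : f = ∑ c, coef c • F c := by
      funext τ; rw [hfdef]; simp [Finset.sum_apply]
    rw [hfeq]
    refine Submodule.sum_mem _ fun c _ => Submodule.smul_mem _ _ ?_
    exact classTheta_mem_span σ h𝔪 ψ (𝔞 := 𝔞r c) rfl (bc c) (hsymmc c) (hposc c) (Θ c) (hΘ c)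
      (hΘ0 c) (fun q => Quotient.out q) (F c) (hF c)
  -- (2) the law on `Γ₀(|d_K| M)`
  have hinv : ∀ γ : SL(2, ℤ), γ ∈ Gamma0 ((discr K).natAbs * Ideal.absNorm 𝔪) → f ∣[(2 : ℤ)] γ = f := by
    intro γ hγ
    obtain ⟨hc, hd⟩ := dvd_and_isCoprime_of_mem_Gamma0 hγ
    have hone := kappa_mul_chi_eq_one hK σ hodd hκJ h𝔪 hψ hneb hd
    funext τ
    rw [ModularForm.SL_slash_apply, ModularGroup.denom_apply]
    have hX : (((γ 1 0 : ℤ) : ℂ) * (τ : ℂ) + ((γ 1 1 : ℤ) : ℂ)) ≠ 0 := by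
      have := UpperHalfPlane.denom_ne_zero γ τ
      rwa [ModularGroup.denom_apply] at this
    have hFc : ∀ c, F c (γ • τ) = (((γ 1 0 : ℤ) : ℂ) * (τ : ℂ) + ((γ 1 1 : ℤ) : ℂ)) ^ 2 * F c τ := by
      intro c
      rw [classTheta_moeb hK σ hprim hodd hquad hζ h𝔪 hψ (𝔞 := 𝔞r c) rfl (h𝔞r0 c) (bc c) (hBc c)
        (hsymmc c) (h00c c) (h11c c) (hdetc c) (hposc c) (Θ c) (hΘ c) (hΘ0 c) (fun q => Quotient.out q)
        (hρ c) (F c) (hF c) hc τ, hone, one_mul]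
    have hfτ : f (γ • τ) = (((γ 1 0 : ℤ) : ℂ) * (τ : ℂ) + ((γ 1 1 : ℤ) : ℂ)) ^ 2 * f τ := by
      rw [hfdef]
      simp only [hFc]
      rw [Finset.mul_sum]
      exact Finset.sum_congr rfl fun c _ => by ring
    rw [hfτ, _root_.zpow_neg, zpow_two]
    field_simp
  -- (3) the cusp form
  obtain ⟨g, hg⟩ := exists_cuspForm_of_mem_span ((discr K).natAbs * Ideal.absNorm 𝔪) hfspan hinv
  refine ⟨g, fun τ => ?_⟩
  rw [hg, hfdef]
  -- (4) the `q`-expansion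
  have hFs : ∀ c, HasSum (fun n : ℕ => (2 * π * I * ∑ᶠ x : {x : 𝓞 K // x ∈ 𝔞r c ∧
      Ideal.absNorm (Ideal.span {x}) = n * Ideal.absNorm (𝔞r c)}, rayClassCoeff 𝔪 ψ (Ideal.span {x.1})) *
        cexp (2 * π * I * (τ : ℂ)) ^ n) (F c τ) := fun c =>
    hasSum_classTheta_nat hK σ h𝔪 h𝔪1 hψ (𝔞 := 𝔞r c) rfl (h𝔞r0 c) (bc c) (hBc c) (hsymmc c) (hposc c)
      (Θ c) (hΘ c) (hΘ0 c) (fun q => Quotient.out q) (hρ c) (F c) (hF c) τ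
  have hsum := hasSum_sum (s := Finset.univ) fun c _ => (hFs c).mul_left (coef c)
  refine hsum.congr_fun fun n => ?_
  rw [show ∑ c, coef c * ((2 * π * I * ∑ᶠ x : {x : 𝓞 K // x ∈ 𝔞r c ∧
      Ideal.absNorm (Ideal.span {x}) = n * Ideal.absNorm (𝔞r c)}, rayClassCoeff 𝔪 ψ (Ideal.span {x.1})) *
        cexp (2 * π * I * (τ : ℂ)) ^ n) =
      (∑ c, coef c * (2 * π * I * ∑ᶠ x : {x : 𝓞 K // x ∈ 𝔞r c ∧
        Ideal.absNorm (Ideal.span {x}) = n * Ideal.absNorm (𝔞r c)}, rayClassCoeff 𝔪 ψ (Ideal.span {x.1}))) *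
        cexp (2 * π * I * (τ : ℂ)) ^ n by
    rw [Finset.sum_mul]; exact Finset.sum_congr rfl fun c _ => by ring]
  congr 1
  symm
  -- the coefficient identity
  by_cases hn : n = 0
  · subst hn
    rw [finsum_absNorm_zero, Literature.NumberTheory.LFunctions.rayClassCoeff_bot]
    refine Finset.sum_eq_zero fun c _ => ?_
    rw [finsum_eq_zero_of_forall_eq_zero, mul_zero, mul_zero]
    intro x
    have h0 : Ideal.absNorm (Ideal.span {(x.1 : 𝓞 K)}) = 0 := by simpa using x.2.2
    rw [Ideal.absNorm_eq_zero_iff.mp h0, Literature.NumberTheory.LFunctions.rayClassCoeff_bot]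
  · -- weighted class count
    have hW := sum_weighted_norm_eq hK (fun c => ⟨𝔞r c, mem_nonZeroDivisors_iff_ne_zero.mpr (h𝔞r0 c)⟩)
      (fun c => (h𝔞r c).2) hn (rayClassCoeff 𝔪 ψ)
      (fun c x => rayClassCoeff 𝔪 ψ (Ideal.span {x}) / rayClassCoeff 𝔪 ψ (𝔞r c)) ?_
    · dsimp only at hW
      calc ∑ c, coef c * (2 * π * I * ∑ᶠ x : {x : 𝓞 K // x ∈ 𝔞r c ∧
              Ideal.absNorm (Ideal.span {x}) = n * Ideal.absNorm (𝔞r c)}, rayClassCoeff 𝔪 ψ (Ideal.span {x.1}))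
          = (((Nat.card (𝓞 K)ˣ : ℕ) : ℂ))⁻¹ * ∑ c, ∑ᶠ x : {x : 𝓞 K // x ∈ 𝔞r c ∧
              Ideal.absNorm (Ideal.span {x}) = n * Ideal.absNorm (𝔞r c)},
              rayClassCoeff 𝔪 ψ (Ideal.span {x.1}) / rayClassCoeff 𝔪 ψ (𝔞r c) := by
            rw [Finset.mul_sum]
            refine Finset.sum_congr rfl fun c _ => ?_
            haveI : Finite {x : 𝓞 K // x ∈ 𝔞r c ∧ Ideal.absNorm (Ideal.span {x}) = n * Ideal.absNorm (𝔞r c)} :=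
              finite_norm_eq hK (𝔞r c) n
            letI : Fintype {x : 𝓞 K // x ∈ 𝔞r c ∧ Ideal.absNorm (Ideal.span {x}) = n * Ideal.absNorm (𝔞r c)} :=
              Fintype.ofFinite _
            rw [finsum_eq_sum_of_fintype, finsum_eq_sum_of_fintype, Finset.mul_sum, Finset.mul_sum,
              Finset.mul_sum]
            refine Finset.sum_congr rfl fun x _ => ?_
            rw [hcoef]
            field_simp
        _ = _ := by
            rw [hW, ← mul_assoc, inv_mul_cancel₀ hw, one_mul, finsum_subtype_absNorm_eq]
    · intro c x J hx hJ
      dsimp only at hx hJ ⊢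
      by_cases hJ0 : J = ⊥
      · subst hJ0
        rw [Ideal.mul_bot] at hJ
        rw [hJ, Literature.NumberTheory.LFunctions.rayClassCoeff_bot, zero_div]
      · have hx0 : Ideal.span {x} ≠ ⊥ := by rw [hJ]; exact mul_ne_zero (h𝔞r0 c) hJ0
        rw [hJ, rayClassCoeff_mul_of_ne_bot 𝔪 ψ (h𝔞r0 c) hJ0, mul_div_cancel_left₀ _ (hrcc0 c)]

end Summit.BirchSwinnertonDyer.BirchSwinnertonDyer.Theorems.HeckeTheta

end
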